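import Summits.QuantumFields.BalabanUV.T4Continuum.Support.NE7StabiliserLifting
import Summits.QuantumFields.BalabanUV.T4Continuum.Support.NE7OneStepOfPathOpen
import HarnessLib

/-!
# NE7StabiliserLiftingUniformEnd — THE `k`-UNIFORM STABILISER LIFTING REDUCED TO TWO LETTERS: a SYMMETRIC CONTINUITY METHOD on the road's own rails
# (`NE7CritClosed.critOneStep_of_continuity'` with the closed predicate «tangent-critical ∧ fixed by the lifted symmetries»), CLOSED half, flat ANCHOR and
# the END (H10 + gen 158's conjugation) in kernel; displayed: (PATH_K) a symmetric small-data path from a symmetric flat datum, (OPEN_K) the symmetric open half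

Cell `pub-balaban`, rung (B)+1 sub-cell t4, lineage `b2b-balaban-t4-ne7b-p1` (row NE7b OWNER + CRUX PROVER; junction service for row NE7, ruling
R-OWNER-149-1 (2)), generation 159.  Memo `t4/b2b-balaban-t4-ne7b-p1/g159/records/SCOPING-uniform-lifting.md`.  ROAD-G115 §5 (iv) «j-uniform δ_V for the
lifting (ask NE7b)»: ✓ p824904 `NE7StabiliserLifting.stabiliser_lifting` quantifies `∀ k ∃ δ_V` because its symmetric interior point comes from the iterated
slab (plaquettes = the datum's) and from the action (`ℓ² → ℓ^∞` over the whole fine torus); the road's consumer ✓ p827687 `NE7MinimiserC1AllData` inherits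
`∀ j ∃ δ_V` from it alone (its other two radii are `k`-free).
THE ROUTE (this file = its END).  For a datum `V₀` and a set `K` of coarse gauge fields fixing `V₀`, put `P_K(U) :=` «`U` is tangent-critical at level `k+1`
∧ `U` is fixed by the block-constant lift `ŝ` of every `s ∈ K`».  F18 ✓ `NE7CritClosed.critOneStep_of_continuity'` runs the clopen induction on `[0,1]` for ANY
predicate `P` with `{U ∈ sfClass | P U}` closed — and `P_K` is closed (✓ `isClosed_tanCritical` ∩ ✓ `isClosed_fixedSet`, §2).  Along a path `γ` of
`K`-SYMMETRIC data from a `K`-symmetric FLAT datum `γ 0` to `γ 1 = V₀` (letter (PATH_K)), the ANCHOR at `γ 0` is the iterated slab of the flat datum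
(✓ `NE7SymmetricAdmissibleWitness.exists_symmetric_admissible` at radius `0`: unitary, periodic, FLAT, admissible, `K̂`-fixed, hence tangent-critical by
✓ `NE7OneStepOfPathOpen.dAction_eq_zero_of_flat`, §1); given the symmetric open half (letter (OPEN_K) — F27's (A)(B)(C)(D) inside `Fix(K̂)`: (APE) and
ALL-SMALL transfer verbatim, the fibre lower-hemicontinuity needs its symmetric form, the minimiser is the RESTRICTED one of ✓ p824273 and its criticality is
restricted Fermat ✓ p824421∕p824642 + Palais ✓ p824112; NOT typed here), the method delivers at `τ = 1` an admissible, tangent-critical, `K̂`-FIXED `U₁` over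
`V₀`; H10 ✓ `NE7CriticalOrbitAnyDatum.critical_is_minimiser_any_datum` makes it a minimiser and every critical admissible configuration its gauge copy, gen 113's
Fermat ✓ `tanCritical_of_isMinimiser_smallData` (data radius `δ_T(ε, N)`, `k`-FREE) makes every minimiser critical, and gen 158's conjugation turns the
`K̂`-fixed minimiser into a lift of every `s ∈ Stab(V₀)` for every minimiser (§3).  The data radius of the END is `δ_T` — `k`-FREE; the letters carry
whatever radius their dischargers need (the road's ALL-SMALL∕(APE) radius, also `k`-free).
WHAT ([folklore]; 0 def, 0 sorry; §1–§2 generic `d`, §3 `d = 4`, every `U(n)`, every `L ≥ 2`).  §1 `symmetric_flat_anchor`; §2 `isClosed_tanCritical_fixed`,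
**`fixedCrit_of_continuity`** (the symmetric continuity method: CLOSED discharged, (OPEN_K) displayed); §3 `lifting_of_fixed_copy` (gen 158's conjugation as a
lemma), **`fixed_minimiser_of_open_path`** (`∃ ε₀ ∀ ε ≤ ε₀ ∀ N ∃ δ_V ∀ k`: a `K̂`-fixed minimiser over every `δ_V`-small `K`-symmetric datum reached by a
(PATH_K)-path along which (OPEN_K) holds, and every minimiser is its gauge copy), **`stabiliser_lifting_uniform_of_open_path`** (`K = Stab(V₀)`: the lifting
theorem of p824904 with `∃ δ_V ∀ k`, MODULO the two letters).
HONEST LIMITS.  (PATH_K) and (OPEN_K) are HYPOTHESES asserted for nothing (their discharge = files S1–S3 of the memo: symmetric fibre-LHC, symmetric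
open-by-minimisation, symmetric soft data path — the last one needs «almost flat and `K`-symmetric ⇒ near a flat `K`-symmetric datum» uniformly in the
symmetry type); nothing of Bałaban's asserted; OUR minimisers ∕ OUR route; NOT NE7 as a spine node, NOT NE3, row NE7b NOT PRINTED ∕ NOT PROVED; spine 0∕9;
finite T⁴ rung (B)+1 — NOT infinite volume, NOT mass gap, NOT BetaPertH, NOT Clay (continuum YM on T⁴ ⇐ BetaPertH ∧ nine spine estimates).
-/

set_option autoImplicit false

open scoped BigOperators Matrix Matrix.Norms.L2Operator Topology
open NormedSpace Finset Set Filter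

namespace Summit.QuantumFields.BalabanUV.T4Continuum.NE7StabiliserLiftingUniformEnd

open Literature.MathematicalPhysics.QuantumFieldTheory.Balaban1983to89
open B7Prop1Explicit B7Prop2Explicit MatrixNorms
open T4AveragingDeficitWall (IsUnitaryCfg IsSkewDir SmallField)
open T4AveragingDeficitWallBoundary (IsPeriodicCfg periodBox)
open AveragingDeficitPeriodicCounting (IsPeriodicDir)
open AveragingDeficitMultiLevelPrep (LevelSmall TangentIter cavgIter)
open AveragingDeficitMultiLevelBridge (cavgIter_eq_avgIter)
open MinimalActionLevels (perWin levelAction)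
open MinimalActionSandwich (IsMinimiser admissible)
open MinimalActionRate (sfClass)
open NE3HessForm (dAction)
open NE3EnergyShapes (IsUnitarySite IsPeriodicSite)
open NE3CpushGaugeCovariance (cavgIter_gaugeAct)
open AveragingDeficitKDatum (gaugeAct_inv_gaugeAct)
open NE7EnergyClassPoincareGeneric (classPackage)
open NE7CriticalOrbitUniqueGeneric (tanCritical_of_isMinimiser_smallData)
open NE7CriticalOrbitAnyDatum (critical_is_minimiser_any_datum)
open NE7SymmetricAdmissibleWitness (exists_symmetric_admissible isClosed_fixedSet)
open NE7StabiliserLiftingPrep (isUnitarySite_lift isPeriodicSite_lift)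
open NE7StabiliserLifting (gaugeAct_mul isPeriodicSite_corner)
open NE7CritClosed (isClosed_tanCritical critOneStep_of_continuity')
open NE7OneStepOfPathOpen (dAction_eq_zero_of_flat)

noncomputable section

variable {d : ℕ} {n : Type} [Fintype n] [DecidableEq n]

/-! ## §1 The anchor: at a flat symmetric datum the iterated slab is a fixed, flat, admissible, tangent-critical configuration -/

/-- **THE SYMMETRIC FLAT ANCHOR** (generic `d`, `L ≥ 1`, every level `k+1`, every `ε ≥ 0`, every radius `r ≥ 0`): over a unitary `N`-periodic FLAT datum `F`
(`SmallField F 0`) fixed by every gauge field of a set `K`, there is an admissible configuration of `sfClass d L N ε` at level `k+1` which is `SmallField · r`,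
tangent-critical (indeed critical along every skew direction — it is flat) and FIXED by the block-constant lift `x ↦ s(⌊x∕L^{k+1}⌋)` of every `s ∈ K` (it is
the iterated slab of `F`).  The `h0` of the symmetric continuity method. [folklore] -/
theorem symmetric_flat_anchor [Nonempty n] {L : ℕ} [NeZero L] (hL : 1 ≤ L) {N : ℕ} (k : ℕ) {ε r : ℝ} (hε : 0 ≤ ε) (hr : 0 ≤ r)
    {F : Site d → Fin d → (Matrix n n ℂ)ˣ} (hFu : IsUnitaryCfg F) (hFP : IsPeriodicCfg F (N : ℤ)) (hF0 : SmallField F 0)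
    (K : Set (Site d → (Matrix n n ℂ)ˣ)) (hK : ∀ s ∈ K, gaugeAct s F = F) :
    ∃ U : Site d → Fin d → (Matrix n n ℂ)ˣ, U ∈ admissible (sfClass d L N ε) L (k + 1) F ∧ SmallField U r ∧
      (∀ φ : Site d → Fin d → Matrix n n ℂ, IsSkewDir φ → IsPeriodicDir φ ((N * L ^ (k + 1) : ℕ) : ℤ) → TangentIter L k U φ →
        dAction U φ (perWin d (N * L ^ (k + 1))) = 0) ∧
      ∀ s ∈ K, gaugeAct (fun x : Site d => s (fun i => x i / ((L : ℤ) ^ (k + 1)))) U = U := by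
  obtain ⟨U, hUu, hUP, hU0, havg, hsym⟩ := exists_symmetric_admissible (n := n) hL (k + 1) hFu hFP le_rfl hF0
  have hx : (0 : ℝ) ≤ ε / ((L : ℝ) ^ (k + 1)) ^ 2 := div_nonneg hε (sq_nonneg _)
  exact ⟨U, ⟨⟨hUu, hUP, MinimalActionRate.SmallField.mono hU0 hx⟩, havg⟩, MinimalActionRate.SmallField.mono hU0 hr,
    fun φ hφ _ _ => dAction_eq_zero_of_flat hUu hU0 hφ _, fun s hs => hsym s (hK s hs)⟩

/-! ## §2 The symmetric continuity method: CLOSED is free for the predicate «tangent-critical ∧ fixed» -/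

/-- **«TANGENT-CRITICAL AND FIXED BY A SET OF GAUGE FIELDS» IS A CLOSED CONDITION ON THE CLASS** (`L ≥ 2`, `ε ≥ 0`, `LevelSmall d L k (ε(L^{k+1})^{−2})`):
✓ `NE7CritClosed.isClosed_tanCritical` ∩ ✓ `NE7SymmetricAdmissibleWitness.isClosed_fixedSet`. [folklore] -/
theorem isClosed_tanCritical_fixed [Nonempty n] {L N k : ℕ} [NeZero N] (hL : 2 ≤ L) {ε : ℝ} (hε : 0 ≤ ε)
    (hls : LevelSmall d L k (ε / ((L : ℝ) ^ (k + 1)) ^ 2)) (𝒲 : Set (Site d → (Matrix n n ℂ)ˣ)) :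
    IsClosed {U : Site d → Fin d → (Matrix n n ℂ)ˣ | U ∈ sfClass d L N ε (k + 1) ∧
      ((∀ φ : Site d → Fin d → Matrix n n ℂ, IsSkewDir φ → IsPeriodicDir φ ((N * L ^ (k + 1) : ℕ) : ℤ) → TangentIter L k U φ →
        dAction U φ (perWin d (N * L ^ (k + 1))) = 0) ∧ ∀ w ∈ 𝒲, gaugeAct w U = U)} := by
  have h : {U : Site d → Fin d → (Matrix n n ℂ)ˣ | U ∈ sfClass d L N ε (k + 1) ∧
      ((∀ φ : Site d → Fin d → Matrix n n ℂ, IsSkewDir φ → IsPeriodicDir φ ((N * L ^ (k + 1) : ℕ) : ℤ) → TangentIter L k U φ →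
        dAction U φ (perWin d (N * L ^ (k + 1))) = 0) ∧ ∀ w ∈ 𝒲, gaugeAct w U = U)}
      = {U : Site d → Fin d → (Matrix n n ℂ)ˣ | U ∈ sfClass d L N ε (k + 1) ∧
          ∀ φ : Site d → Fin d → Matrix n n ℂ, IsSkewDir φ → IsPeriodicDir φ ((N * L ^ (k + 1) : ℕ) : ℤ) → TangentIter L k U φ →
            dAction U φ (perWin d (N * L ^ (k + 1))) = 0} ∩ {U | ∀ w ∈ 𝒲, gaugeAct w U = U} := by
    ext U
    simp only [mem_setOf_eq, mem_inter_iff, and_assoc]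
  rw [h]
  exact (isClosed_tanCritical (N := N) hL hε hls).inter (isClosed_fixedSet 𝒲)

/-- **THE SYMMETRIC CONTINUITY METHOD — CLOSED DISCHARGED, ANCHOR DISCHARGED, (OPEN_K) DISPLAYED** (generic `d`, `L ≥ 2`, level `k+1` of `sfClass d L N ε` in the
compactness regime `16C₀ε ≤ 3`, `1024(d+1)(d+4)L²ε ≤ 1`, `LevelSmall d L k (ε(L^{k+1})^{−2})`; radius `r ≥ 0`).  Let `K` be a set of coarse gauge fields and
`γ` a data path, continuous on `[0,1]`, whose values are unitary, `N`-periodic and FIXED by every `s ∈ K`, with `γ 0` FLAT.  ASSUME (OPEN_K): near every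
parameter carrying an admissible, `SmallField · r`, tangent-critical configuration fixed by the lifts `K̂` of `K`, every parameter carries one.  THEN every
`τ ∈ [0,1]` carries one — in particular `γ 1`.  (F18 ✓ `critOneStep_of_continuity'` with `P := P_K`; `h0` = §1; closedness = `isClosed_tanCritical_fixed`.)
[folklore] -/
theorem fixedCrit_of_continuity [Nonempty n] {L N k : ℕ} [NeZero L] [NeZero N] (hL : 2 ≤ L) {ε r : ℝ} (hε0 : 0 ≤ ε) (hr : 0 ≤ r)
    (hε1 : 16 * C0 d * ε ≤ 3) (hε2 : 1024 * (d + 1) * (d + 4) * (L : ℝ) ^ 2 * ε ≤ 1) (hls : LevelSmall d L k (ε / ((L : ℝ) ^ (k + 1)) ^ 2))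
    (K : Set (Site d → (Matrix n n ℂ)ˣ))
    (γ : ℝ → (Site d → Fin d → (Matrix n n ℂ)ˣ)) (hγ : ContinuousOn γ (Icc (0 : ℝ) 1))
    (hγu : ∀ τ ∈ Icc (0 : ℝ) 1, IsUnitaryCfg (γ τ)) (hγP : ∀ τ ∈ Icc (0 : ℝ) 1, IsPeriodicCfg (γ τ) (N : ℤ))
    (hγK : ∀ τ ∈ Icc (0 : ℝ) 1, ∀ s ∈ K, gaugeAct s (γ τ) = γ τ) (hγ0 : SmallField (γ 0) 0)
    (hopen : ∀ τ₀ ∈ Icc (0 : ℝ) 1,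
      (∃ U : Site d → Fin d → (Matrix n n ℂ)ˣ, U ∈ admissible (sfClass d L N ε) L (k + 1) (γ τ₀) ∧ SmallField U r ∧
        (∀ φ : Site d → Fin d → Matrix n n ℂ, IsSkewDir φ → IsPeriodicDir φ ((N * L ^ (k + 1) : ℕ) : ℤ) → TangentIter L k U φ →
          dAction U φ (perWin d (N * L ^ (k + 1))) = 0) ∧
        ∀ s ∈ K, gaugeAct (fun x : Site d => s (fun i => x i / ((L : ℤ) ^ (k + 1)))) U = U) →
      ∃ ρ : ℝ, 0 < ρ ∧ ∀ τ ∈ Icc (0 : ℝ) 1, |τ - τ₀| < ρ →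
        ∃ U : Site d → Fin d → (Matrix n n ℂ)ˣ, U ∈ admissible (sfClass d L N ε) L (k + 1) (γ τ) ∧ SmallField U r ∧
          (∀ φ : Site d → Fin d → Matrix n n ℂ, IsSkewDir φ → IsPeriodicDir φ ((N * L ^ (k + 1) : ℕ) : ℤ) → TangentIter L k U φ →
            dAction U φ (perWin d (N * L ^ (k + 1))) = 0) ∧
          ∀ s ∈ K, gaugeAct (fun x : Site d => s (fun i => x i / ((L : ℤ) ^ (k + 1)))) U = U) :
    ∀ τ ∈ Icc (0 : ℝ) 1, ∃ U : Site d → Fin d → (Matrix n n ℂ)ˣ, U ∈ admissible (sfClass d L N ε) L (k + 1) (γ τ) ∧ SmallField U r ∧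
      (∀ φ : Site d → Fin d → Matrix n n ℂ, IsSkewDir φ → IsPeriodicDir φ ((N * L ^ (k + 1) : ℕ) : ℤ) → TangentIter L k U φ →
        dAction U φ (perWin d (N * L ^ (k + 1))) = 0) ∧
      ∀ s ∈ K, gaugeAct (fun x : Site d => s (fun i => x i / ((L : ℤ) ^ (k + 1)))) U = U := by
  have hL1 : 1 ≤ L := by omega
  set 𝒲 : Set (Site d → (Matrix n n ℂ)ˣ) :=
    (fun s : Site d → (Matrix n n ℂ)ˣ => fun x : Site d => s (fun i => x i / ((L : ℤ) ^ (k + 1)))) '' K with h𝒲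
  -- the lifted-fixedness clause, in the two spellings
  have hfixW : ∀ U : Site d → Fin d → (Matrix n n ℂ)ˣ,
      (∀ w ∈ 𝒲, gaugeAct w U = U) ↔ ∀ s ∈ K, gaugeAct (fun x : Site d => s (fun i => x i / ((L : ℤ) ^ (k + 1)))) U = U := by
    intro U
    constructor
    · intro h s hs
      exact h _ ⟨s, hs, rfl⟩
    · rintro h w ⟨s, hs, rfl⟩
      exact h s hs
  -- the predicate `P_K` in the `𝒲`-spelling
  set P : (Site d → Fin d → (Matrix n n ℂ)ˣ) → Prop := fun U =>
    (∀ φ : Site d → Fin d → Matrix n n ℂ, IsSkewDir φ → IsPeriodicDir φ ((N * L ^ (k + 1) : ℕ) : ℤ) → TangentIter L k U φ →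
      dAction U φ (perWin d (N * L ^ (k + 1))) = 0) ∧ ∀ w ∈ 𝒲, gaugeAct w U = U with hPdef
  -- the anchor at `γ 0`
  have h0I : (0 : ℝ) ∈ Icc (0 : ℝ) 1 := ⟨le_rfl, zero_le_one⟩
  obtain ⟨U0, hU0adm, hU0r, hU0crit, hU0fix⟩ :=
    symmetric_flat_anchor (n := n) (L := L) hL1 (N := N) k hε0 hr (hγu 0 h0I) (hγP 0 h0I) hγ0 K (hγK 0 h0I)
  have h0 : ∃ U : Site d → Fin d → (Matrix n n ℂ)ˣ, U ∈ admissible (sfClass d L N ε) L (k + 1) (γ 0) ∧ SmallField U r ∧ P U :=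
    ⟨U0, hU0adm, hU0r, hU0crit, (hfixW U0).mpr hU0fix⟩
  -- (OPEN_K) in the `𝒲`-spelling
  have hopen' : ∀ τ₀ ∈ Icc (0 : ℝ) 1,
      (∃ U : Site d → Fin d → (Matrix n n ℂ)ˣ, U ∈ admissible (sfClass d L N ε) L (k + 1) (γ τ₀) ∧ SmallField U r ∧ P U) →
      ∃ ρ : ℝ, 0 < ρ ∧ ∀ τ ∈ Icc (0 : ℝ) 1, |τ - τ₀| < ρ →
        ∃ U : Site d → Fin d → (Matrix n n ℂ)ˣ, U ∈ admissible (sfClass d L N ε) L (k + 1) (γ τ) ∧ SmallField U r ∧ P U := by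
    rintro τ₀ hτ₀ ⟨U, hUadm, hUr, hUcrit, hUfix⟩
    obtain ⟨ρ, hρ, hball⟩ := hopen τ₀ hτ₀ ⟨U, hUadm, hUr, hUcrit, (hfixW U).mp hUfix⟩
    refine ⟨ρ, hρ, fun τ hτ hτρ => ?_⟩
    obtain ⟨U', hU'adm, hU'r, hU'crit, hU'fix⟩ := hball τ hτ hτρ
    exact ⟨U', hU'adm, hU'r, hU'crit, (hfixW U').mpr hU'fix⟩
  have hall := critOneStep_of_continuity' (d := d) (n := n) (N := N) hL hε0 hε1 hε2 γ hγ P h0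
    (by rw [hPdef]; exact isClosed_tanCritical_fixed (N := N) hL hε0 hls 𝒲) hopen'
  intro τ hτ
  obtain ⟨U, hUadm, hUr, hUcrit, hUfix⟩ := hall τ hτ
  exact ⟨U, hUadm, hUr, hUcrit, (hfixW U).mp hUfix⟩

/-! ## §3 The END (`d = 4`): a fixed minimiser, every minimiser its copy, hence the lifting — uniformly in the level, modulo (PATH_K) and (OPEN_K) -/

/-- **GEN 158's CONJUGATION AS A LEMMA** (`d = 4`, `L ≥ 1`, level `j+1`, `LevelSmall 4 L j (ε(L^{j+1})^{−2})`): if `U₁` is fixed by the block-constant lift of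
EVERY unitary `N`-periodic gauge field fixing the datum `V₀`, `U` is admissible at level `j+1` over `V₀`, and `U^{u} = U₁` for a unitary `(N·L^{j+1})`-periodic
`u`, then every unitary `N`-periodic `s` fixing `V₀` lifts to a unitary `(N·L^{j+1})`-periodic `h` fixing `U` with corners `h(L^{j+1}•z) = s(z)`: the corner field
`c` of `u` fixes `V₀` (`cavgIter_gaugeAct`), `s′ := c s c⁻¹` fixes `V₀`, `ŝ′` fixes `U₁`, and `h := u⁻¹ ŝ′ u`. [folklore] -/
theorem lifting_of_fixed_copy [Nonempty n] {L : ℕ} (hL : 1 ≤ L) {N : ℕ} (j : ℕ) {ε : ℝ} (hε : 0 ≤ ε)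
    (hls : LevelSmall 4 L j (ε / ((L : ℝ) ^ (j + 1)) ^ 2))
    {V₀ U U₁ : Site 4 → Fin 4 → (Matrix n n ℂ)ˣ} (hU₁avg : avgIter L U₁ (j + 1) = V₀)
    (hU₁fix : ∀ s : Site 4 → (Matrix n n ℂ)ˣ, IsUnitarySite s → IsPeriodicSite s (N : ℤ) → gaugeAct s V₀ = V₀ →
      gaugeAct (fun x : Site 4 => s (fun i => x i / ((L : ℤ) ^ (j + 1)))) U₁ = U₁)
    (hU : U ∈ admissible (sfClass 4 L N ε) L (j + 1) V₀)
    {u : Site 4 → (Matrix n n ℂ)ˣ} (hu : IsUnitarySite u) (huP : IsPeriodicSite u ((N * L ^ (j + 1) : ℕ) : ℤ)) (hug : gaugeAct u U = U₁) :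
    ∀ s : Site 4 → (Matrix n n ℂ)ˣ, IsUnitarySite s → IsPeriodicSite s (N : ℤ) → gaugeAct s V₀ = V₀ →
      ∃ h : Site 4 → (Matrix n n ℂ)ˣ, IsUnitarySite h ∧ IsPeriodicSite h ((N * L ^ (j + 1) : ℕ) : ℤ) ∧ gaugeAct h U = U ∧
        ∀ z : Site 4, h (((L : ℤ) ^ (j + 1)) • z) = s z := by
  classical
  intro s hsu hsP hsfix
  have hLk : 1 ≤ L ^ (j + 1) := Nat.one_le_pow _ _ hL
  have hLk0 : ((L : ℤ) ^ (j + 1)) ≠ 0 := pow_ne_zero _ (by exact_mod_cast (by omega : L ≠ 0))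
  have hcast : (((L ^ (j + 1) : ℕ) : ℤ)) = (L : ℤ) ^ (j + 1) := by push_cast; ring
  -- the corner field of `u` fixes the datum
  set c : Site 4 → (Matrix n n ℂ)ˣ := fun z => u (((L : ℤ) ^ (j + 1)) • z) with hc
  have hcu : IsUnitarySite c := fun z => hu _
  have hcP : IsPeriodicSite c (N : ℤ) := by
    have huP' : IsPeriodicSite u ((N * L ^ (j + 1) : ℕ) : ℤ) := huP
    have h := isPeriodicSite_corner (M := L ^ (j + 1)) huP'
    simp only [hcast] at h
    exact h
  have hcfix : gaugeAct c V₀ = V₀ := by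
    obtain ⟨⟨hUu, hUP, hUε⟩, hUavg⟩ := hU
    have hx : 0 ≤ ε / ((L : ℝ) ^ (j + 1)) ^ 2 := by positivity
    have h1 := cavgIter_gaugeAct (d := 4) hL j hUu hx hls hUε (u := u) hu
    rw [hug, cavgIter_eq_avgIter, cavgIter_eq_avgIter, hU₁avg, hUavg] at h1
    exact h1.symm
  -- the conjugated stabiliser element and its lift
  set s' : Site 4 → (Matrix n n ℂ)ˣ := fun z => c z * s z * (c z)⁻¹ with hs'
  have hs'u : IsUnitarySite s' := fun z =>
    (unitaryUnits (Matrix n n ℂ)).mul_mem ((unitaryUnits (Matrix n n ℂ)).mul_mem (hcu z) (hsu z)) ((unitaryUnits (Matrix n n ℂ)).inv_mem (hcu z))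
  have hs'P : IsPeriodicSite s' (N : ℤ) := fun z i => by simp only [hs', hcP z i, hsP z i]
  have hcinv : gaugeAct (fun z => (c z)⁻¹) V₀ = V₀ := by
    conv_lhs => rw [← hcfix]
    exact gaugeAct_inv_gaugeAct c V₀
  have hs'fix : gaugeAct s' V₀ = V₀ := by
    have h1 : s' = fun z => (fun z => c z * s z) z * (fun z => (c z)⁻¹) z := rfl
    rw [h1, gaugeAct_mul, gaugeAct_mul, hcinv, hsfix, hcfix]
  have hlift : gaugeAct (fun x : Site 4 => s' (fun i => x i / ((L : ℤ) ^ (j + 1)))) U₁ = U₁ := hU₁fix s' hs'u hs'P hs'fix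
  -- the lift of `s`
  refine ⟨fun x => (u x)⁻¹ * ((fun x : Site 4 => s' (fun i => x i / ((L : ℤ) ^ (j + 1)))) x * u x), fun x => ?_, fun x i => ?_, ?_, fun z => ?_⟩
  · exact (unitaryUnits (Matrix n n ℂ)).mul_mem ((unitaryUnits (Matrix n n ℂ)).inv_mem (hu x))
      ((unitaryUnits (Matrix n n ℂ)).mul_mem (hs'u _) (hu x))
  · have hp := isPeriodicSite_lift (d := 4) hs'P hLk x i
    simp only [hcast] at hp
    have hup := huP x i
    simp only [hp, hup]
  · rw [gaugeAct_mul, gaugeAct_mul, hug, hlift, ← hug, gaugeAct_inv_gaugeAct]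
  · have hdiv : (fun i => (((L : ℤ) ^ (j + 1)) • z) i / ((L : ℤ) ^ (j + 1))) = z := by
      funext i
      simp only [Pi.smul_apply, smul_eq_mul]
      exact Int.mul_ediv_cancel_left _ hLk0
    show (u (((L : ℤ) ^ (j + 1)) • z))⁻¹ * (s' (fun i => (((L : ℤ) ^ (j + 1)) • z) i / ((L : ℤ) ^ (j + 1))) * u (((L : ℤ) ^ (j + 1)) • z)) = s z
    rw [hdiv]
    show (c z)⁻¹ * (c z * s z * (c z)⁻¹ * c z) = s z
    group

/-- **THE END, PART (a): A FIXED MINIMISER OVER EVERY SMALL SYMMETRIC DATUM REACHED BY A SYMMETRIC PATH ALONG WHICH (OPEN_K) HOLDS — AND EVERY MINIMISER IS ITS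
GAUGE COPY — UNIFORMLY IN THE LEVEL** (`d = 4`, every `U(n)`, `L ≥ 2`).  For `0 < ε ≤ ε₀` and `N ≥ 1` there is `δ_V > 0` (gen 113's Fermat radius; `k`-FREE) such
that for EVERY level `k+1`, every radius `r ≥ 0`, every datum `V₀` with `SmallField V₀ δ_V`, every set `K` of coarse gauge fields and every data path `γ`
(continuous on `[0,1]`, unitary `N`-periodic `K`-fixed values, `γ 0` flat, `γ 1 = V₀`) along which (OPEN_K) holds at level `k+1` with radius `r`: there is a
minimiser `U₁` of `sfClass 4 L N ε` at level `k+1` over `V₀`, `SmallField · r`, FIXED by the lift of every `s ∈ K`, and every minimiser over `V₀` is `U₁^{u}`-wise its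
gauge copy (`gaugeAct u U = U₁`, `u` unitary `(N·L^{k+1})`-periodic). [folklore] -/
theorem fixed_minimiser_of_open_path [Nonempty n] {L : ℕ} (hL : 2 ≤ L) :
    ∃ ε₀ : ℝ, 0 < ε₀ ∧ ∀ ε : ℝ, 0 < ε → ε ≤ ε₀ → ∀ (N : ℕ) [NeZero N], 1 ≤ N → ∃ δV : ℝ, 0 < δV ∧
      ∀ (k : ℕ) (r : ℝ), 0 ≤ r → ∀ (V₀ : Site 4 → Fin 4 → (Matrix n n ℂ)ˣ) (K : Set (Site 4 → (Matrix n n ℂ)ˣ))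
        (γ : ℝ → (Site 4 → Fin 4 → (Matrix n n ℂ)ˣ)),
        SmallField V₀ δV → ContinuousOn γ (Icc (0 : ℝ) 1) → γ 1 = V₀ →
        (∀ τ ∈ Icc (0 : ℝ) 1, IsUnitaryCfg (γ τ) ∧ IsPeriodicCfg (γ τ) (N : ℤ) ∧ ∀ s ∈ K, gaugeAct s (γ τ) = γ τ) →
        SmallField (γ 0) 0 →
        (∀ τ₀ ∈ Icc (0 : ℝ) 1,
          (∃ U : Site 4 → Fin 4 → (Matrix n n ℂ)ˣ, U ∈ admissible (sfClass 4 L N ε) L (k + 1) (γ τ₀) ∧ SmallField U r ∧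
            (∀ φ : Site 4 → Fin 4 → Matrix n n ℂ, IsSkewDir φ → IsPeriodicDir φ ((N * L ^ (k + 1) : ℕ) : ℤ) → TangentIter L k U φ →
              dAction U φ (perWin 4 (N * L ^ (k + 1))) = 0) ∧
            ∀ s ∈ K, gaugeAct (fun x : Site 4 => s (fun i => x i / ((L : ℤ) ^ (k + 1)))) U = U) →
          ∃ ρ : ℝ, 0 < ρ ∧ ∀ τ ∈ Icc (0 : ℝ) 1, |τ - τ₀| < ρ →
            ∃ U : Site 4 → Fin 4 → (Matrix n n ℂ)ˣ, U ∈ admissible (sfClass 4 L N ε) L (k + 1) (γ τ) ∧ SmallField U r ∧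
              (∀ φ : Site 4 → Fin 4 → Matrix n n ℂ, IsSkewDir φ → IsPeriodicDir φ ((N * L ^ (k + 1) : ℕ) : ℤ) → TangentIter L k U φ →
                dAction U φ (perWin 4 (N * L ^ (k + 1))) = 0) ∧
              ∀ s ∈ K, gaugeAct (fun x : Site 4 => s (fun i => x i / ((L : ℤ) ^ (k + 1)))) U = U) →
        ∃ U₁ : Site 4 → Fin 4 → (Matrix n n ℂ)ˣ, IsMinimiser 4 (sfClass 4 L N ε) L N (k + 1) V₀ U₁ ∧ SmallField U₁ r ∧
          (∀ s ∈ K, gaugeAct (fun x : Site 4 => s (fun i => x i / ((L : ℤ) ^ (k + 1)))) U₁ = U₁) ∧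
          ∀ U : Site 4 → Fin 4 → (Matrix n n ℂ)ˣ, IsMinimiser 4 (sfClass 4 L N ε) L N (k + 1) V₀ U →
            ∃ u : Site 4 → (Matrix n n ℂ)ˣ, IsUnitarySite u ∧ IsPeriodicSite u ((N * L ^ (k + 1) : ℕ) : ℤ) ∧ gaugeAct u U = U₁ := by
  classical
  haveI : NeZero L := ⟨by omega⟩
  have hL1 : 1 ≤ L := by omega
  obtain ⟨εH, hεH, H10⟩ := critical_is_minimiser_any_datum (n := n) hL
  obtain ⟨εT, hεT, HT⟩ := tanCritical_of_isMinimiser_smallData (n := n) hL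
  obtain ⟨θ₀, CF, CE, hθ₀, -, -, -, hC0θ, hDθ, hlsP, -, -⟩ := classPackage (n := n) (d := 4) (by norm_num) hL
  refine ⟨min εH (min εT θ₀), lt_min hεH (lt_min hεT hθ₀), fun ε hε hεle N _ hN => ?_⟩
  have hεH' : ε ≤ εH := hεle.trans (min_le_left _ _)
  have hεT' : ε ≤ εT := hεle.trans ((min_le_right _ _).trans (min_le_left _ _))
  have hεθ : ε ≤ θ₀ := hεle.trans ((min_le_right _ _).trans (min_le_right _ _))
  have hls : ∀ j : ℕ, LevelSmall 4 L j (ε / ((L : ℝ) ^ (j + 1)) ^ 2) := hlsP hε.le hεθ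
  have hε1 : 16 * C0 4 * ε ≤ 3 := (mul_le_mul_of_nonneg_left hεθ (by have := C0_pos 4; positivity)).trans hC0θ
  have hε2 : 1024 * ((4 : ℕ) + 1 : ℝ) * ((4 : ℕ) + 4 : ℝ) * (L : ℝ) ^ 2 * ε ≤ 1 :=
    (mul_le_mul_of_nonneg_left hεθ (by positivity)).trans hDθ
  obtain ⟨δT, hδT, hT⟩ := HT ε hε hεT' N hN
  refine ⟨δT, hδT, fun k r hr V₀ K γ hV₀δ hγ hγ1 hγdata hγ0 hopen => ?_⟩
  have hγu : ∀ τ ∈ Icc (0 : ℝ) 1, IsUnitaryCfg (γ τ) := fun τ hτ => (hγdata τ hτ).1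
  have hγP : ∀ τ ∈ Icc (0 : ℝ) 1, IsPeriodicCfg (γ τ) (N : ℤ) := fun τ hτ => (hγdata τ hτ).2.1
  have hγK : ∀ τ ∈ Icc (0 : ℝ) 1, ∀ s ∈ K, gaugeAct s (γ τ) = γ τ := fun τ hτ => (hγdata τ hτ).2.2
  have h1I : (1 : ℝ) ∈ Icc (0 : ℝ) 1 := ⟨zero_le_one, le_rfl⟩
  obtain ⟨U₁, hU₁adm, hU₁r, hU₁crit, hU₁fix⟩ :=
    fixedCrit_of_continuity (d := 4) (n := n) hL hε.le hr hε1 hε2 (hls k) K γ hγ hγu hγP hγK hγ0 hopen 1 h1I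
  rw [hγ1] at hU₁adm
  have hV₀u : IsUnitaryCfg V₀ := by rw [← hγ1]; exact hγu 1 h1I
  have hV₀P : IsPeriodicCfg V₀ (N : ℤ) := by rw [← hγ1]; exact hγP 1 h1I
  -- H10: the fixed tangent-critical admissible configuration is a minimiser, and every critical admissible one is its copy
  have hcrit : ∀ j : ℕ, k + 1 = j + 1 → ∀ φ : Site 4 → Fin 4 → Matrix n n ℂ, IsSkewDir φ → IsPeriodicDir φ ((N * L ^ (j + 1) : ℕ) : ℤ) →
      TangentIter L j U₁ φ → dAction U₁ φ (perWin 4 (N * L ^ (j + 1))) = 0 := by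
    intro j hj φ hφs hφP hφT
    obtain rfl : k = j := by omega
    exact hU₁crit φ hφs hφP hφT
  obtain ⟨hU₁min, horbit⟩ := H10 ε hε hεH' N hN V₀ (k + 1) U₁ hU₁adm hcrit
  refine ⟨U₁, hU₁min, hU₁r, hU₁fix, fun U hU => ?_⟩
  -- every minimiser over the `δ_T`-small datum is critical (gen 113's Fermat), hence a copy of `U₁`
  have hV₀T : V₀ ∈ {V : Site 4 → Fin 4 → (Matrix n n ℂ)ˣ | IsUnitaryCfg V ∧ IsPeriodicCfg V (N : ℤ) ∧ SmallField V δT} :=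
    ⟨hV₀u, hV₀P, hV₀δ⟩
  have hcritU : ∀ j : ℕ, k + 1 = j + 1 → ∀ φ : Site 4 → Fin 4 → Matrix n n ℂ, IsSkewDir φ → IsPeriodicDir φ ((N * L ^ (j + 1) : ℕ) : ℤ) →
      TangentIter L j U φ → dAction U φ (perWin 4 (N * L ^ (j + 1))) = 0 := by
    intro j hj φ hφs hφP hφT
    obtain rfl : k = j := by omega
    exact hT V₀ hV₀T k U hU φ hφs hφP hφT
  exact horbit U hU.mem hcritU

/-- **THE END, PART (b): `k`-UNIFORM STABILISER LIFTING MODULO (PATH_K) AND (OPEN_K)** (`d = 4`, every `U(n)`, `L ≥ 2`) — ✓ p824904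
`NE7StabiliserLifting.stabiliser_lifting` with the quantifiers `∃ δ_V ∀ k`, CONDITIONAL on the two letters at `K = Stab(V₀)`: for `0 < ε ≤ ε₀`, `N ≥ 1` there is
`δ_V > 0` such that at EVERY level `k+1`, for every datum `V₀` with `SmallField V₀ δ_V` joined by a `Stab(V₀)`-symmetric data path from a flat datum along which
(OPEN_{Stab(V₀)}) holds (some radius `r ≥ 0`), every minimiser `U` over `V₀` and every unitary `N`-periodic `s` fixing `V₀` admit a unitary
`(N·L^{k+1})`-periodic `h` with `U^{h} = U` and `h(L^{k+1}•z) = s(z)`. [folklore] -/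
theorem stabiliser_lifting_uniform_of_open_path [Nonempty n] {L : ℕ} (hL : 2 ≤ L) :
    ∃ ε₀ : ℝ, 0 < ε₀ ∧ ∀ ε : ℝ, 0 < ε → ε ≤ ε₀ → ∀ (N : ℕ) [NeZero N], 1 ≤ N → ∃ δV : ℝ, 0 < δV ∧
      ∀ (k : ℕ) (r : ℝ), 0 ≤ r → ∀ (V₀ : Site 4 → Fin 4 → (Matrix n n ℂ)ˣ) (γ : ℝ → (Site 4 → Fin 4 → (Matrix n n ℂ)ˣ)),
        SmallField V₀ δV → ContinuousOn γ (Icc (0 : ℝ) 1) → γ 1 = V₀ →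
        (∀ τ ∈ Icc (0 : ℝ) 1, IsUnitaryCfg (γ τ) ∧ IsPeriodicCfg (γ τ) (N : ℤ) ∧
          ∀ s ∈ {s : Site 4 → (Matrix n n ℂ)ˣ | IsUnitarySite s ∧ IsPeriodicSite s (N : ℤ) ∧ gaugeAct s V₀ = V₀}, gaugeAct s (γ τ) = γ τ) →
        SmallField (γ 0) 0 →
        (∀ τ₀ ∈ Icc (0 : ℝ) 1,
          (∃ U : Site 4 → Fin 4 → (Matrix n n ℂ)ˣ, U ∈ admissible (sfClass 4 L N ε) L (k + 1) (γ τ₀) ∧ SmallField U r ∧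
            (∀ φ : Site 4 → Fin 4 → Matrix n n ℂ, IsSkewDir φ → IsPeriodicDir φ ((N * L ^ (k + 1) : ℕ) : ℤ) → TangentIter L k U φ →
              dAction U φ (perWin 4 (N * L ^ (k + 1))) = 0) ∧
            ∀ s ∈ {s : Site 4 → (Matrix n n ℂ)ˣ | IsUnitarySite s ∧ IsPeriodicSite s (N : ℤ) ∧ gaugeAct s V₀ = V₀},
              gaugeAct (fun x : Site 4 => s (fun i => x i / ((L : ℤ) ^ (k + 1)))) U = U) →
          ∃ ρ : ℝ, 0 < ρ ∧ ∀ τ ∈ Icc (0 : ℝ) 1, |τ - τ₀| < ρ →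
            ∃ U : Site 4 → Fin 4 → (Matrix n n ℂ)ˣ, U ∈ admissible (sfClass 4 L N ε) L (k + 1) (γ τ) ∧ SmallField U r ∧
              (∀ φ : Site 4 → Fin 4 → Matrix n n ℂ, IsSkewDir φ → IsPeriodicDir φ ((N * L ^ (k + 1) : ℕ) : ℤ) → TangentIter L k U φ →
                dAction U φ (perWin 4 (N * L ^ (k + 1))) = 0) ∧
              ∀ s ∈ {s : Site 4 → (Matrix n n ℂ)ˣ | IsUnitarySite s ∧ IsPeriodicSite s (N : ℤ) ∧ gaugeAct s V₀ = V₀},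
                gaugeAct (fun x : Site 4 => s (fun i => x i / ((L : ℤ) ^ (k + 1)))) U = U) →
        ∀ U : Site 4 → Fin 4 → (Matrix n n ℂ)ˣ, IsMinimiser 4 (sfClass 4 L N ε) L N (k + 1) V₀ U →
        ∀ s : Site 4 → (Matrix n n ℂ)ˣ, IsUnitarySite s → IsPeriodicSite s (N : ℤ) → gaugeAct s V₀ = V₀ →
          ∃ h : Site 4 → (Matrix n n ℂ)ˣ, IsUnitarySite h ∧ IsPeriodicSite h ((N * L ^ (k + 1) : ℕ) : ℤ) ∧ gaugeAct h U = U ∧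
            ∀ z : Site 4, h (((L : ℤ) ^ (k + 1)) • z) = s z := by
  classical
  haveI : NeZero L := ⟨by omega⟩
  have hL1 : 1 ≤ L := by omega
  obtain ⟨ε₁, hε₁, H⟩ := fixed_minimiser_of_open_path (n := n) hL
  obtain ⟨θ₀, CF, CE, hθ₀, -, -, -, -, -, hlsP, -, -⟩ := classPackage (n := n) (d := 4) (by norm_num) hL
  refine ⟨min ε₁ θ₀, lt_min hε₁ hθ₀, fun ε hε hεle N _ hN => ?_⟩
  have hεθ : ε ≤ θ₀ := hεle.trans (min_le_right _ _)
  have hls : ∀ j : ℕ, LevelSmall 4 L j (ε / ((L : ℝ) ^ (j + 1)) ^ 2) := hlsP hε.le hεθ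
  obtain ⟨δV, hδV, H1⟩ := H ε hε (hεle.trans (min_le_left _ _)) N hN
  refine ⟨δV, hδV, fun k r hr V₀ γ hV₀δ hγ hγ1 hγdata hγ0 hopen U hU s hsu hsP hsfix => ?_⟩
  obtain ⟨U₁, hU₁min, -, hU₁fix, hcopy⟩ :=
    H1 k r hr V₀ {s : Site 4 → (Matrix n n ℂ)ˣ | IsUnitarySite s ∧ IsPeriodicSite s (N : ℤ) ∧ gaugeAct s V₀ = V₀} γ hV₀δ hγ hγ1 hγdata hγ0 hopen
  obtain ⟨u, hu, huP, hug⟩ := hcopy U hU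
  exact lifting_of_fixed_copy (n := n) hL1 k hε.le (hls k) hU₁min.mem.2 (fun s' hs'u hs'P hs'fix => hU₁fix s' ⟨hs'u, hs'P, hs'fix⟩)
    hU.mem hu huP hug s hsu hsP hsfix

end

end Summit.QuantumFields.BalabanUV.T4Continuum.NE7StabiliserLiftingUniformEnd
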